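import Summits.AtomisticToContinuum.Crystallization.Theorems.ChargedEnergyGapCoreFree
import HarnessLib

/-!
(SPLIT FOR THE 400-LINE CAP by the landing lane, hand-2 g30: this file = part A; part B = `…ChargedEnergyGapWeightLedger` imports it; same namespace, all FQNs unchanged.)
# `ChargedEnergyGap` — the GENERIC WEIGHT LEDGER: parts I-B…N-A over an abstract core weight system
# (cell `decomp-a2c`, lens 3, generation 52, node «WeightLedger», part O-A; over part N-A `…Theorems.ChargedEnergyGapCoreFree`)

THE QUESTION OF RECORD (critic g20, row 1005 (b)).  The far weight of record (SUM cover, part I-A) makes the cored far leaf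
CB-FAR_G|cored false-leaning (transfer audit, memo g51 §2); the repair R1 (MAX cover, part N-B, not of record) and a soft-max variant
R1′ are candidates, and the census (C10/C11) decides.  Ruling: «prove [the re-chaining] is mechanical: every ledger lemma of I-B…M-A
must go through with ONLY `w ∈ [0,1]`, `w = 0` on `ϱ/2`-cores, `w > 0 ⇒` cores beyond `ϱ/2`, `Λ`-periodicity, `Σψ + w = 1` — list
any lemma that used smoothness or the sum form.»

THE ANSWER, AS A THEOREM.  This part re-derives the whole weight-dependent ledger of parts I-B (accounts, ★ ledger identity,
conservation of credits), L-C (neighbourhood debits, ★ immunity, ★ packing), L-D (regular/gross split under the guard), M-A (near-gross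
sites, ★ summed immunity, clean account) and N-A (★ core-free floor) ONCE, over an ABSTRACT CORE WEIGHT SYSTEM `W : CoreWeights θ ε R r
η L δ L' ϱ` — a family of ball weights `W.ball Q x : E3 → ℝ` (one per motif site) and a far weight `W.far Q : E3 → ℝ` subject to
EXACTLY these axioms and nothing else:
  (W1) `0 ≤ ball`, (W2) `0 ≤ far`, (W3) `Σ_x ball_x + far = 1` (partition of unity),
  (W4) `ball_x ≡ 0` unless `x` is an incoherent core, (W5) `far = 0` AT every incoherent core,
  (W6) `0 < far q ⇒` every core orbit is `> ϱ/2` from `q` (`0 < ϱ`), (W7)/(W8) `Λ`-periodicity of `ball_x` and `far`.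
Part O-B states the pieces (REG-BALL_W, CLEAN-FAR_W, LABEL_W, CB-FAR_W, CB-FAR_W|cored), proves the glue to the guarded engine
target NGP_G, the EQUIV CB-FAR_W ⟺ CB-FAR_W|cored and ★★ the record cone FOR EVERY `W`, and instantiates `W` at the weights of
record (the tree leaves are recovered DEFINITIONALLY).  FINDING: no lemma of parts I-B…N-A uses the smoothness of the weights or the
sum form of the cover — smoothness and the cover's shape enter only the TRUTH of the far leaf (the transfer audit), never the
ledger.  (W6) is used by no ledger lemma either; it is kept because it is the semantics of the selector `0 < far` of LABEL / CB-FAR.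

§0 `CoreWeights` and derived facts.  §1 Accounts and the three exact identities (I-B).  §2 Neighbourhood debits, immunity, packing
(L-C).  §3 Regular ball account, near-gross sites, summed immunity, clean far account and the one-sided guard splits (L-D, M-A).
§4 The core-free clean floor (N-A).

TAGS.  EQUIV / bookkeeping re-base (no new piece; every statement here is PROVED for every weight system). -/

noncomputable section
open scoped Classical
open Literature.MathematicalPhysics.StatisticalMechanics
open Literature.Geometry.DiscreteGeometry
open Summit.AtomisticToContinuum.Crystallization.Theses.PricedLinkCensus
open Summit.AtomisticToContinuum.Crystallization.Theorems.ChargedEnergyGapNegative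

namespace Summit.AtomisticToContinuum.Crystallization.Theorems.ChargedEnergyGapChartDial

/-! ## §0 Abstract core weight systems -/

/-- A **CORE WEIGHT SYSTEM** at the species dials `(θ, ε, R, r, η, L, δ, L')` and scale `ϱ`: ball weights `ball Q x` (one per motif
site `x`, carried by the incoherent cores only) and a far weight `far Q`, functions on space, forming a non-negative partition of
unity, with the far weight vanishing at the cores, positive only beyond `ϱ/2` from every core orbit, and everything `Λ`-periodic.
The weights of record (part I-A) and the max-cover weights (part N-B) are instances (part O-B / O-C). -/
structure CoreWeights (θ ε R r η L δ L' ϱ : ℝ) where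
  /-- the ball weight of motif site `x` at the point `q` -/
  ball : ∀ Q : PeriodicConfiguration 3, Q.motif → E3 → ℝ
  /-- the far weight at the point `q` -/
  far : PeriodicConfiguration 3 → E3 → ℝ
  /-- (W1) ball weights are non-negative -/
  ball_nonneg : ∀ (Q : PeriodicConfiguration 3) (x : Q.motif) (q : E3), 0 ≤ ball Q x q
  /-- (W2) the far weight is non-negative -/
  far_nonneg : ∀ (Q : PeriodicConfiguration 3) (q : E3), 0 ≤ far Q q
  /-- (W3) partition of unity -/
  sum_ball_add_far : ∀ (Q : PeriodicConfiguration 3) (q : E3), (∑ x : Q.motif, ball Q x q) + far Q q = 1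
  /-- (W4) only incoherent cores carry ball weights -/
  ball_of_not_isCore : ∀ (Q : PeriodicConfiguration 3) (x : Q.motif), ¬ IsCore θ ε R r η L δ L' Q x → ∀ q : E3, ball Q x q = 0
  /-- (W5) the far weight vanishes at every incoherent core -/
  far_of_isCore : ∀ (Q : PeriodicConfiguration 3) (y : Q.motif), IsCore θ ε R r η L δ L' Q y → far Q (y : E3) = 0
  /-- (W6) positive far weight ⟹ every core orbit is beyond `ϱ/2` -/
  lt_orbitDist_of_far_pos : 0 < ϱ → ∀ (Q : PeriodicConfiguration 3) (q : E3), 0 < far Q q →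
    ∀ x : Q.motif, IsCore θ ε R r η L δ L' Q x → ϱ / 2 < orbitDist Q x q
  /-- (W7) ball weights are `Λ`-periodic -/
  ball_add_period : ∀ (Q : PeriodicConfiguration 3) (x : Q.motif) (g : E3), g ∈ Q.lattice → ∀ q : E3, ball Q x (q + g) = ball Q x q
  /-- (W8) the far weight is `Λ`-periodic -/
  far_add_period : ∀ (Q : PeriodicConfiguration 3) (g : E3), g ∈ Q.lattice → ∀ q : E3, far Q (q + g) = far Q q

namespace CoreWeights

variable {θ ε R r η L δ L' ϱ : ℝ} (W : CoreWeights θ ε R r η L δ L' ϱ)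

/-- The ball weights at `q` sum to `1 − far q`. -/
theorem ball_sum_eq (Q : PeriodicConfiguration 3) (q : E3) : (∑ x : Q.motif, W.ball Q x q) = 1 - W.far Q q := by
  have h := W.sum_ball_add_far Q q
  linarith

/-- The far weight is at most `1`. -/
theorem far_le_one (Q : PeriodicConfiguration 3) (q : E3) : W.far Q q ≤ 1 := by
  have h := W.sum_ball_add_far Q q
  have h0 : 0 ≤ ∑ x : Q.motif, W.ball Q x q := Finset.sum_nonneg fun x _ => W.ball_nonneg Q x q
  linarith

/-- Every ball weight is at most `1`. -/
theorem ball_le_one (Q : PeriodicConfiguration 3) (x : Q.motif) (q : E3) : W.ball Q x q ≤ 1 := by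
  have h := W.sum_ball_add_far Q q
  have h1 : W.ball Q x q ≤ ∑ x' : Q.motif, W.ball Q x' q :=
    Finset.single_le_sum (f := fun x' : Q.motif => W.ball Q x' q) (fun x' _ => W.ball_nonneg Q x' q) (Finset.mem_univ x)
  linarith [W.far_nonneg Q q]

/-- ★ At an incoherent core the ball weights sum to `1` EXACTLY (W3 + W5). -/
theorem ball_sum_of_isCore {Q : PeriodicConfiguration 3} {y : Q.motif} (hy : IsCore θ ε R r η L δ L' Q y) :
    (∑ x : Q.motif, W.ball Q x (y : E3)) = 1 := by
  rw [W.ball_sum_eq, W.far_of_isCore Q y hy, sub_zero]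

/-- A core-free configuration is ALL far matter: `far ≡ 1` (W3 + W4). -/
theorem far_eq_one_of_forall_not_isCore {Q : PeriodicConfiguration 3} (h : ∀ x : Q.motif, ¬ IsCore θ ε R r η L δ L' Q x) (q : E3) :
    W.far Q q = 1 := by
  have hs := W.sum_ball_add_far Q q
  have h0 : (∑ x : Q.motif, W.ball Q x q) = 0 := Finset.sum_eq_zero fun x _ => W.ball_of_not_isCore Q x (h x) q
  linarith

end CoreWeights

/-! ## §1 The accounts and the three exact identities (part I-B over `W`) -/

section Ledger

variable {θ ε R r η L δ L' ϱ : ℝ} (W : CoreWeights θ ε R r η L δ L' ϱ)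

/-- The **BALL ACCOUNT** of `x`: `W.ball x`-weighted site excess over the motif. -/
def ballExcessW (Q : PeriodicConfiguration 3) (x : Q.motif) : ℝ :=
  ∑ y : Q.motif, W.ball Q x (y : E3) * (siteEnergy Q (y : E3) - eStar)

/-- The **FAR ACCOUNT**: `W.far`-weighted site excess over the motif. -/
def farExcessW (Q : PeriodicConfiguration 3) : ℝ :=
  ∑ y : Q.motif, W.far Q (y : E3) * (siteEnergy Q (y : E3) - eStar)

/-- Weighted number of cores in the ball of `x` (the CREDIT count). -/
def ballCoreCountW (Q : PeriodicConfiguration 3) (x : Q.motif) : ℝ :=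
  ∑ y : Q.motif, if IsCore θ ε R r η L δ L' Q y then W.ball Q x (y : E3) else 0

/-- The **REGULAR BALL ACCOUNT** of `x`: the ball account with every other-gross site's own term deleted (part L-D). -/
def ballRegularExcessW (Q : PeriodicConfiguration 3) (x : Q.motif) : ℝ :=
  ∑ y : Q.motif, if IsOtherGross θ ε R r η L δ L' Q y then 0 else W.ball Q x (y : E3) * (siteEnergy Q (y : E3) - eStar)

/-- The weighted core count is non-negative. -/
theorem ballCoreCountW_nonneg (Q : PeriodicConfiguration 3) (x : Q.motif) : 0 ≤ ballCoreCountW W Q x :=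
  Finset.sum_nonneg fun y _ => by split_ifs; exacts [W.ball_nonneg Q x _, le_rfl]

/-- A non-core site has the zero ball account … -/
theorem ballExcessW_of_not_isCore {Q : PeriodicConfiguration 3} {x : Q.motif} (hx : ¬ IsCore θ ε R r η L δ L' Q x) :
    ballExcessW W Q x = 0 := by
  simp [ballExcessW, W.ball_of_not_isCore Q x hx]

/-- … the zero regular ball account … -/
theorem ballRegularExcessW_of_not_isCore {Q : PeriodicConfiguration 3} {x : Q.motif} (hx : ¬ IsCore θ ε R r η L δ L' Q x) :
    ballRegularExcessW W Q x = 0 := by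
  simp [ballRegularExcessW, W.ball_of_not_isCore Q x hx]

/-- … and the zero credit count. -/
theorem ballCoreCountW_of_not_isCore {Q : PeriodicConfiguration 3} {x : Q.motif} (hx : ¬ IsCore θ ε R r η L δ L' Q x) :
    ballCoreCountW W Q x = 0 := by
  simp [ballCoreCountW, W.ball_of_not_isCore Q x hx]

/-- ★★ **THE LEDGER** (exact; W3 only): `excess Q = Σ_x ballExcessW x + farExcessW`. -/
theorem excess_eq_sum_ballExcessW_add_farExcessW (Q : PeriodicConfiguration 3) :
    excess Q = (∑ x : Q.motif, ballExcessW W Q x) + farExcessW W Q := by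
  rw [← sum_siteExcess_eq_excess Q]
  simp only [ballExcessW, farExcessW]
  rw [Finset.sum_comm, ← Finset.sum_add_distrib]
  refine Finset.sum_congr rfl fun y _ => ?_
  rw [← Finset.sum_mul, ← add_mul, W.sum_ball_add_far, one_mul]

/-- ★ **CONSERVATION OF CREDITS** (W3 + W5): the credit counts add up to the number of cores EXACTLY. -/
theorem sum_ballCoreCountW_eq (Q : PeriodicConfiguration 3) :
    (∑ x : Q.motif, ballCoreCountW W Q x) = (motifCoreIncoherent θ ε R r η L δ L' Q : ℝ) := by
  rw [← sum_ite_isCore_eq θ ε R r η L δ L' Q]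
  simp only [ballCoreCountW]
  rw [Finset.sum_comm]
  refine Finset.sum_congr rfl fun y _ => ?_
  by_cases hy : IsCore θ ε R r η L δ L' Q y
  · simp only [hy, if_true]; exact W.ball_sum_of_isCore hy
  · simp [hy]

/-- Typed end (W3 + W4): with no cores the far account is the whole excess. -/
theorem farExcessW_eq_excess_of_forall_not_isCore {Q : PeriodicConfiguration 3} (h : ∀ x : Q.motif, ¬ IsCore θ ε R r η L δ L' Q x) :
    farExcessW W Q = excess Q := by
  rw [excess_eq_sum_ballExcessW_add_farExcessW W Q]
  simp [ballExcessW_of_not_isCore W (h _)]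

end Ledger

/-! ## §2 Neighbourhood debits, immunity and packing (part L-C over `W`) -/

section Debits

variable {θ ε R r η L δ L' ϱ : ℝ} (W : CoreWeights θ ε R r η L δ L' ϱ) (ρ₀ : ℝ)

/-- The **NEIGHBOURHOOD DEBIT of the ball account of `x`**: every point within `ρ₀` of an other-gross motif site, weighted by `W.ball x`. -/
def ballNearDebitW (Q : PeriodicConfiguration 3) (x : Q.motif) : ℝ :=
  ∑ z : Q.motif, if IsOtherGross θ ε R r η L δ L' Q z then ∑ q ∈ nearPoints ρ₀ Q (z : E3), W.ball Q x q else 0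

/-- The **NEIGHBOURHOOD DEBIT of the far account**: the same with `W.far`. -/
def farNearDebitW (Q : PeriodicConfiguration 3) : ℝ :=
  ∑ z : Q.motif, if IsOtherGross θ ε R r η L δ L' Q z then ∑ q ∈ nearPoints ρ₀ Q (z : E3), W.far Q q else 0

variable {ρ₀}

/-- The ball neighbourhood debit is non-negative (W1). -/
theorem ballNearDebitW_nonneg (Q : PeriodicConfiguration 3) (x : Q.motif) : 0 ≤ ballNearDebitW W ρ₀ Q x :=
  Finset.sum_nonneg fun z _ => by
    split_ifs
    exacts [Finset.sum_nonneg fun q _ => W.ball_nonneg Q x q, le_rfl]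

/-- The far neighbourhood debit is non-negative (W2). -/
theorem farNearDebitW_nonneg (Q : PeriodicConfiguration 3) : 0 ≤ farNearDebitW W ρ₀ Q :=
  Finset.sum_nonneg fun z _ => by
    split_ifs
    exacts [Finset.sum_nonneg fun q _ => W.far_nonneg Q q, le_rfl]

/-- ★ **IMMUNITY (ball accounts)** (W1 + W7): a motif site within `ρ₀` of any lattice translate of an other-gross motif site is debited
in the ball account of every `x` with its full weight. -/
theorem ball_le_ballNearDebitW {Q : PeriodicConfiguration 3} (x y : Q.motif) {z : Q.motif} (hz : IsOtherGross θ ε R r η L δ L' Q z)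
    {g : E3} (hg : g ∈ Q.lattice) (hd : dist (y : E3) ((z : E3) + g) ≤ ρ₀) : W.ball Q x (y : E3) ≤ ballNearDebitW W ρ₀ Q x := by
  have hq : (y : E3) - g ∈ nearPoints ρ₀ Q (z : E3) := by
    refine mem_nearPoints.2 ⟨?_, ?_⟩
    · simpa [sub_eq_add_neg] using Q.add_mem_points (Q.mem_points_of_mem_motif y.2) (Q.lattice.neg_mem hg)
    · have h1 : dist ((y : E3) - g) (z : E3) = dist (y : E3) ((z : E3) + g) := by
        rw [dist_eq_norm, dist_eq_norm]; congr 1; abel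
      rwa [h1]
  have hw : W.ball Q x (y : E3) = W.ball Q x ((y : E3) - g) := by
    rw [← W.ball_add_period Q x g hg ((y : E3) - g), sub_add_cancel]
  calc W.ball Q x (y : E3) ≤ ∑ q ∈ nearPoints ρ₀ Q (z : E3), W.ball Q x q := by
        rw [hw]; exact Finset.single_le_sum (fun q _ => W.ball_nonneg Q x q) hq
    _ = (if IsOtherGross θ ε R r η L δ L' Q z then ∑ q ∈ nearPoints ρ₀ Q (z : E3), W.ball Q x q else 0) := by rw [if_pos hz]
    _ ≤ ballNearDebitW W ρ₀ Q x :=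
        Finset.single_le_sum (f := fun z : Q.motif => if IsOtherGross θ ε R r η L δ L' Q z then
            ∑ q ∈ nearPoints ρ₀ Q (z : E3), W.ball Q x q else 0)
          (fun z _ => by
            split_ifs
            exacts [Finset.sum_nonneg fun q _ => W.ball_nonneg Q x q, le_rfl])
          (Finset.mem_univ z)

/-- ★ **IMMUNITY (far account)** (W2 + W8). -/
theorem far_le_farNearDebitW {Q : PeriodicConfiguration 3} (y : Q.motif) {z : Q.motif} (hz : IsOtherGross θ ε R r η L δ L' Q z)
    {g : E3} (hg : g ∈ Q.lattice) (hd : dist (y : E3) ((z : E3) + g) ≤ ρ₀) : W.far Q (y : E3) ≤ farNearDebitW W ρ₀ Q := by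
  have hq : (y : E3) - g ∈ nearPoints ρ₀ Q (z : E3) := by
    refine mem_nearPoints.2 ⟨?_, ?_⟩
    · simpa [sub_eq_add_neg] using Q.add_mem_points (Q.mem_points_of_mem_motif y.2) (Q.lattice.neg_mem hg)
    · have h1 : dist ((y : E3) - g) (z : E3) = dist (y : E3) ((z : E3) + g) := by
        rw [dist_eq_norm, dist_eq_norm]; congr 1; abel
      rwa [h1]
  have hw : W.far Q (y : E3) = W.far Q ((y : E3) - g) := by
    rw [← W.far_add_period Q g hg ((y : E3) - g), sub_add_cancel]
  calc W.far Q (y : E3) ≤ ∑ q ∈ nearPoints ρ₀ Q (z : E3), W.far Q q := by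
        rw [hw]; exact Finset.single_le_sum (fun q _ => W.far_nonneg Q q) hq
    _ = (if IsOtherGross θ ε R r η L δ L' Q z then ∑ q ∈ nearPoints ρ₀ Q (z : E3), W.far Q q else 0) := by rw [if_pos hz]
    _ ≤ farNearDebitW W ρ₀ Q :=
        Finset.single_le_sum (f := fun z : Q.motif => if IsOtherGross θ ε R r η L δ L' Q z then
            ∑ q ∈ nearPoints ρ₀ Q (z : E3), W.far Q q else 0)
          (fun z _ => by
            split_ifs
            exacts [Finset.sum_nonneg fun q _ => W.far_nonneg Q q, le_rfl])
          (Finset.mem_univ z)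

/-- The other-gross sites' own ball weights are covered by the neighbourhood debit (`0 ≤ ρ₀`; W1). -/
theorem sum_ball_otherGross_le_ballNearDebitW (hρ : 0 ≤ ρ₀) (Q : PeriodicConfiguration 3) (x : Q.motif) :
    (∑ y : Q.motif, if IsOtherGross θ ε R r η L δ L' Q y then W.ball Q x (y : E3) else 0) ≤ ballNearDebitW W ρ₀ Q x := by
  refine Finset.sum_le_sum fun z _ => ?_
  by_cases hz : IsOtherGross θ ε R r η L δ L' Q z
  · rw [if_pos hz, if_pos hz]
    exact Finset.single_le_sum (fun q _ => W.ball_nonneg Q x q)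
      (mem_nearPoints.2 ⟨Q.mem_points_of_mem_motif z.2, by rw [dist_self]; exact hρ⟩)
  · rw [if_neg hz, if_neg hz]

/-- ★ **THE PACKING IDENTITY** (W3): all neighbourhood debits together count every (perpetrator, nearby point) pair exactly once. -/
theorem sum_ballNearDebitW_add_farNearDebitW_eq (Q : PeriodicConfiguration 3) :
    (∑ x : Q.motif, ballNearDebitW W ρ₀ Q x) + farNearDebitW W ρ₀ Q =
      ∑ z : Q.motif, if IsOtherGross θ ε R r η L δ L' Q z then ((nearPoints ρ₀ Q (z : E3)).card : ℝ) else 0 := by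
  simp only [ballNearDebitW, farNearDebitW]
  rw [Finset.sum_comm, ← Finset.sum_add_distrib]
  refine Finset.sum_congr rfl fun z _ => ?_
  by_cases hz : IsOtherGross θ ε R r η L δ L' Q z
  · simp only [if_pos hz]
    rw [← Finset.sum_comm, ← Finset.sum_add_distrib, Finset.card_eq_sum_ones, Nat.cast_sum, Nat.cast_one]
    exact Finset.sum_congr rfl fun q _ => W.sum_ball_add_far Q q
  · simp only [if_neg hz, Finset.sum_const_zero, add_zero]

/-- ★ **THE PACKING BOUND UNDER THE GUARD** (W3): `Σ_x ballNearDebitW x + farNearDebitW ≤ (2ρ₀/s + 1)³ · #other`. -/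
theorem sum_ballNearDebitW_add_farNearDebitW_le {s : ℝ} {Q : PeriodicConfiguration 3} (hG : Guard ε s Q) (hs : 0 < s) (hρ : 0 ≤ ρ₀) :
    (∑ x : Q.motif, ballNearDebitW W ρ₀ Q x) + farNearDebitW W ρ₀ Q ≤
      (2 * ρ₀ / s + 1) ^ 3 * (Nat.card {x : Q.motif // IsOtherGross θ ε R r η L δ L' Q x} : ℝ) := by
  rw [sum_ballNearDebitW_add_farNearDebitW_eq, ← sum_ite_isOtherGross_eq θ ε R r η L δ L' Q, Finset.mul_sum]
  refine Finset.sum_le_sum fun z _ => ?_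
  by_cases hz : IsOtherGross θ ε R r η L δ L' Q z
  · rw [if_pos hz, if_pos hz, mul_one]; exact card_nearPoints_le hG hs hρ _
  · rw [if_neg hz, if_neg hz, mul_zero]

end Debits

end Summit.AtomisticToContinuum.Crystallization.Theorems.ChargedEnergyGapChartDial

end
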